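import Mathlib
import HarnessLib
import Summits.HubbardSuperconductivity.HubbardSuperconductivity.Theorems.KLProgrammeKLRegimeEngineTowerWtLawOfBlocksKlEng
import Summits.HubbardSuperconductivity.HubbardSuperconductivity.Theorems.KLProgrammeKLRegimeOverlapWtFlowAllUnif

/-!
# ♯4 RE-THREAD, FILE A («D-ORDER», located by p4 g22 KL STATUS l.11984, booked pen (R411)(C)/(R416)(B)(2)): THE WEIGHTED LINK DATA AND THE ONE-TRACK
# WEIGHTED TOWER LAW ON `K_n` WITH THE d-FREE CONSTANTS `C₁ C₂ Cκ CJ` SEALED BEFORE `∀ d` (only the alpha constant `Cb` after it)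
# Route `KLProgramme` — crux K3 ENGINE (stmt-HubbardSuperconductivity-20437 `KLRegimeEngineV17F2`), stub (b) v2, THE WEIGHTED HALF «(b)-WT4»
# (cell gate-hubbard-kl, seat hubbard-kl-k3c3-p2 g18; ∃-rescoping twins of W2b `linkDataW_klEng` (…TowerWtStepLinkKlEng, p698287) and W5
#  `klTowerBornWtAt_le_law_of_blocks_klEng_tokX` (…TowerWtLawOfBlocksKlEng, p700238) on this lineage's `overlapWt_towerBlock_klEng_flow_all_unif` (g16, p4-era
#  «(ℓ)-BLOCKLEN-CJ-UNIFORM»); bodies and proofs verbatim, the intro of `d` moved after the d-free constants; E1 may rename or supersede)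

WHY.  The numerics of the ∀j-assembly must choose the block length `d` so that the blocking row `Z·C₂²·2^{−(d−1)}·max Q′ Q_b ≤ Q″`, `4Q″ ≤ Q′`, `2τψQ″ ≤ Q′`
is satisfiable — under the KlEng pins `Z = ε_x²c̄c²/8`, `c̄c = 162·max(CJ, CJr)·M/β`, `2τψ = 8e⁴`: `2^{d−1} ≥ 8e⁴·(81·max CJ CJr)²/2·C₂²`, i.e. `d ≥ d₀(C₂, CJ, CJr)`.
In the chain as landed (W2b → W5 → W8 → … → `kernelNormsWt4_all_klEng_final_sharp3`) every statement takes `d` FIRST and seals `C₂ CJ CJr` afterwards, so the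
choice is formally circular («D-ORDER»).  In value `C₁ C₂` (W3b `klTowerBornWtAt_le_law_of_base_rows_klEng_tokX R c″`), `Cκ` (the Gram door) and `CJ` (the uniform
overlap door `overlapWt_towerBlock_klEng_flow_all_unif R c″`) do not depend on `d`; only the alpha constant `Cb` does.  This file re-scopes accordingly:
* §1 **`linkDataW_klEng_unif (R c″)`** — `∃ Cκ CJ > 0, ∀ d, ∃ Cb > 0, <body of linkDataW_klEng d R c″>`;
* §2 **`klTowerBornWtAt_le_law_of_blocks_klEng_tokX_unif (R c″)`** — `∃ C₁ C₂ Cκ CJ > 0, ∀ d, ∃ Cb > 0, (R.WF2 → <body of W5>)`.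
Compositions/re-scopings of landed theorems; nothing about the model is asserted beyond them; nothing asserts (b), (ℓ), any stub, K3 or superconductivity.
References: BGM 2006 §2.3 (2.13)–(2.14), §2.7 (2.71a), §2.8 (2.76)–(2.84), (2.93)–(2.98), §3 (3.2)–(3.8) [cite: BenfattoGiulianiMastropietro2006].
-/

noncomputable section

namespace Summit.HubbardSuperconductivity.HubbardSuperconductivity.Theorems.EngineV8

set_option linter.dupNamespace false -- summit = problem name (single-conjunct summit), D-0017

open Classical
open Real Finset Literature.MathematicalPhysics.QuantumLattice Literature.Probability.LatticeModels GrassmannAlgebra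
open Literature.MathematicalPhysics.QuantumLattice.FermiRG Literature.MathematicalPhysics.QuantumLattice.FermiRG.BGM2006Routing
open Summit.HubbardSuperconductivity.HubbardSuperconductivity.Theorems.KLProgrammeLegKernels
open Summit.HubbardSuperconductivity.HubbardSuperconductivity.Theorems.KLRegimeSplit
open Summit.HubbardSuperconductivity.HubbardSuperconductivity.Theorems.KLRegimeWick
open Summit.HubbardSuperconductivity.HubbardSuperconductivity.Theorems.TwoPointAssembly
open Summit.HubbardSuperconductivity.HubbardSuperconductivity.Theorems.DispersionFlow
open Summit.HubbardSuperconductivity.HubbardSuperconductivity.Theorems.TorusFourierL2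

variable {L M : ℕ} [NeZero L] [NeZero M]

/-! ## §1 The per-block WEIGHTED LINK data with `∃ Cκ CJ` before `∀ d` -/

/-- **d-UNIFORM form of W2b `linkDataW_klEng`** («D-ORDER» cure at the source): `∃ Cκ CJ > 0` (the Gram door and the UNIFORM overlap door, both d-free)
BEFORE `∀ d`, then `∃ Cb > 0` (the alpha door's constant depends on the block length); the body — the eight per-block hypotheses of the weighted LINK at
every rate `j ≥ dk` on `K_n` — and the proof are those of `linkDataW_klEng`. [cite: BenfattoGiulianiMastropietro2006, §2.7 (2.71a), §2.8 (2.77), (2.81)-(2.83)] -/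
theorem linkDataW_klEng_unif (R : RenConsts) (c'' : ℝ) (hc'' : 0 < c'') :
    ∃ Cκ CJ : ℝ, 0 < Cκ ∧ 0 < CJ ∧ ∀ d : ℕ, ∃ Cb : ℝ, 0 < Cb ∧
      ∀ (G : GeoConsts) (P : SplitConsts) (Q : EngConsts) (c : ℝ), P.WF → R.WF2 → 0 < c → c ≤ klEngC₃6 P R →
      ∀ μ ∈ klWindowC, ∀ U : ℝ, 0 < U → U ≤ klEngU₀9 P R c → c'' * U ≤ 1 →
      ∀ β : ℝ, klBetaMin ≤ β → β ≤ Real.exp (c / U ^ 2) →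
      ∀ (L M : ℕ) [NeZero L] [NeZero M], klEngL₃ β U ≤ L → klEngM₃ β U L ≤ M →
      ∀ n : ℕ, 1 ≤ n → n ≤ nScales β + 1 → IsKLRegime U c (-(n : ℤ)) →
        HistP klPredsV17F2 L M G P Q R β U μ 0 n → FrameOK R U (nScales β) μ (klFlowFrameU L M β U μ n) →
        (∀ m, 1 ≤ m → m < n → FlowPieceOscAt L M c'' β U μ m) →
      ∀ k : ℕ, 1 ≤ k → 2 ≤ d * k → d * (k + 1) ≤ nScales β + 1 → d * k ≤ n → ∀ j : ℕ, d * k ≤ j →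
        0 < Real.sqrt (Cκ * (klScale klE0 (d * k) / klScale klE0 (d * k - 1)) * (klE0 * ((8 : ℝ) ^ (d * k - 1))⁻¹)) ∧
        Real.sqrt (Cκ * (klScale klE0 (d * k) / klScale klE0 (d * k - 1)) * (klE0 * ((8 : ℝ) ^ (d * k - 1))⁻¹)) ^ 2 * (8 : ℝ) ^ (d * k) ≤ Real.sqrt (2 * Cκ * klE0) ^ 2 ∧
        IsGramBoundedR ((sectorSubMatrix L M β (bgmFatMultiplier L M klE0 β (nambuXiCT L μ (klFlowFrameU L M β U μ n)) (d * k - 1))).transpose * hubbardCovSliceCT L M β μ 0 (klFlowFrameU L M β U μ n) (klScale klE0 (d * (k + 1))) (klScale klE0 (d * k)) * sectorSubMatrix L M β (bgmFatMultiplier L M klE0 β (nambuXiCT L μ (klFlowFrameU L M β U μ n)) (d * k - 1))) (Real.sqrt (Cκ * (klScale klE0 (d * k) / klScale klE0 (d * k - 1)) * (klE0 * ((8 : ℝ) ^ (d * k - 1))⁻¹))) ∧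
        (∀ X, ∑ Y, ‖((sectorSubMatrix L M β (bgmFatMultiplier L M klE0 β (nambuXiCT L μ (klFlowFrameU L M β U μ n)) (d * k - 1))).transpose * hubbardCovSliceCT L M β μ 0 (klFlowFrameU L M β U μ n) (klScale klE0 (d * (k + 1))) (klScale klE0 (d * k)) * sectorSubMatrix L M β (bgmFatMultiplier L M klE0 β (nambuXiCT L μ (klFlowFrameU L M β U μ n)) (d * k - 1))) X Y‖ *
            klScaleWt L M β j {latticeLegPos (2 * (2 * M)) X, latticeLegPos (2 * (2 * M)) Y} ≤ Cb * ((M : ℝ) / β) / klScale klE0 (d * (k + 1))) ∧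
        (∀ Y, ∑ X, ‖((sectorSubMatrix L M β (bgmFatMultiplier L M klE0 β (nambuXiCT L μ (klFlowFrameU L M β U μ n)) (d * k - 1))).transpose * hubbardCovSliceCT L M β μ 0 (klFlowFrameU L M β U μ n) (klScale klE0 (d * (k + 1))) (klScale klE0 (d * k)) * sectorSubMatrix L M β (bgmFatMultiplier L M klE0 β (nambuXiCT L μ (klFlowFrameU L M β U μ n)) (d * k - 1))) X Y‖ *
            klScaleWt L M β j {latticeLegPos (2 * (2 * M)) X, latticeLegPos (2 * (2 * M)) Y} ≤ Cb * ((M : ℝ) / β) / klScale klE0 (d * (k + 1))) ∧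
        Cb * ((M : ℝ) / β) / klScale klE0 (d * (k + 1)) ≤ Cb * ((M : ℝ) / β) * (4 : ℝ) ^ d / klE0 * (4 : ℝ) ^ (d * k) ∧
        (∀ X'', ∑ X', ‖(sectorAnalysisMatrix L M β (klAnisoFamily L M β μ (klFlowFrameU L M β U μ n) klE0 (d * k)) * sectorSubMatrix L M β (bgmFatMultiplier L M klE0 β (nambuXiCT L μ (klFlowFrameU L M β U μ n)) (d * k - 1))) X'' X'‖ *
            klScaleWt L M β j {latticeLegPos (2 * (2 * M)) X'', latticeLegPos (2 * (2 * M)) X'} ≤ 81 * CJ * M / β) ∧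
        (∀ X', ∑ X'', ‖(sectorAnalysisMatrix L M β (klAnisoFamily L M β μ (klFlowFrameU L M β U μ n) klE0 (d * k)) * sectorSubMatrix L M β (bgmFatMultiplier L M klE0 β (nambuXiCT L μ (klFlowFrameU L M β U μ n)) (d * k - 1))) X'' X'‖ *
            klScaleWt L M β j {latticeLegPos (2 * (2 * M)) X'', latticeLegPos (2 * (2 * M)) X'} ≤ 162 * CJ * M / β) := by
  obtain ⟨Cκ, hCκ, hg⟩ := gram_sliceCT_bgmFat_sharp_klEng
  obtain ⟨CJ, hCJ, hop⟩ := overlapWt_towerBlock_klEng_flow_all_unif R c'' hc''.le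
  refine ⟨Cκ, CJ, hCκ, hCJ, fun d => ?_⟩
  obtain ⟨Cb, hCb, hαp⟩ := alphaWt_towerBlock_klEng_flow_all' d R c'' hc''
  refine ⟨Cb, hCb, ?_⟩
  intro G P Q c hP hR2 hc hc6 μ hμ U hU hU9 hcU β hβmin hβc L M _ _ hL3 hM3 n hn1 hnN hreg hhist hfr hosc k hk1 hdk hkN hkn j hkj
  have he : (0 : ℝ) < klE0 := by norm_num [klE0]
  have hβ : 0 < β := KLRegimeSplit.pos_of_klBetaMin_le hβmin
  have hM0 : (0 : ℝ) < M := Nat.cast_pos.2 (Nat.pos_of_ne_zero (NeZero.ne M))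
  have hU4 : U ≤ klEngU₀4 P R c := hU9.trans (klEngU₀9_le_klEngU₀4 P R c)
  have hU3g : U ≤ min (klEngU₀3 P R c) (1 / (R.Gfr 3 + 1)) :=
    le_min (hU9.trans (klEngU₀9_le_klEngU₀3 P R c)) (hU9.trans (klEngU₀9_le_inv_gfr_add_one P hR2.wf c (by norm_num)))
  have hc3 : c ≤ klEngC₃3 P R := hc6.trans (klEngC₃6_le_klEngC₃3 P R)
  set K : TrigPolyC4v := klFlowFrameU L M β U μ n with hKdef
  obtain ⟨hrow, hcol⟩ := hαp G P Q c hR2 hc hc6 μ hμ U hU hU3g hcU β hβmin hβc L M hL3 hM3 n hn1 hnN hreg hhist hosc k hk1 hdk hkN j hkj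
  obtain ⟨hrow', hcol'⟩ := hop d G P Q c hR2 hc hc6 μ hμ U hU hU3g hcU β hβmin hβc L M hL3 hM3 n hn1 hnN hreg hhist hosc k (by omega) hkn j hkj
  refine ⟨?_, ?_, ?_, hrow, hcol, ?_, hrow', ?_⟩
  · have h1 : 0 < klScale klE0 (d * k) := klth_klScale_pos _
    have h2 : 0 < klScale klE0 (d * k - 1) := klth_klScale_pos _
    exact Real.sqrt_pos.2 (by positivity)
  · rw [gramF_sq_mul_pow_eq hCκ.le (by omega)]
  · have hΛpos : 0 < klScale klE0 (d * (k + 1)) := klth_klScale_pos _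
    have hΛle : klScale klE0 (d * (k + 1)) ≤ klScale klE0 (d * k) := klScale_le_klScale he.le (Nat.mul_le_mul_left d (Nat.le_succ k))
    have hΛle' : klScale klE0 (d * k) ≤ klScale klE0 (d * k - 1) := klScale_le_klScale he.le (by omega)
    obtain ⟨m, hm⟩ : ∃ m, d * k - 1 = m + 1 := ⟨d * k - 2, by omega⟩
    have hmul : d * (k + 1) = d * k + d := Nat.mul_succ d k
    have h := (hg P R c hP hR2 hc hc3 μ hμ U hU hU4 β hβmin hβc K hfr L M hL3 hM3 m (by omega)
      (klScale klE0 (d * (k + 1))) (klScale klE0 (d * k)) hΛpos hΛle (by rw [← hm]; exact hΛle')).2.1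
    rw [← hm] at h
    exact h
  · rw [alphaF_eq_bound_mul_pow]
  · have h2 : (2 : ℝ) ^ (d * k - (d * k - 1)) = 2 := by rw [show d * k - (d * k - 1) = 1 by omega, pow_one]
    intro X'
    have h := hcol' X'
    rw [h2] at h
    exact h.trans (le_of_eq (by ring))

/-! ## §2 The one-track weighted law on `K_n` with `∃ C₁ C₂ Cκ CJ` before `∀ d` -/

/-- **d-UNIFORM form of W5 `klTowerBornWtAt_le_law_of_blocks_klEng_tokX`** («D-ORDER» cure): `∃ C₁ C₂ Cκ CJ > 0` BEFORE `∀ d` (`C₁ C₂` from the d-free W3b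
`klTowerBornWtAt_le_law_of_base_rows_klEng_tokX`, `Cκ CJ` from §1), then `∃ Cb > 0` and `R.WF2 → ∃ c₃′ U₀′`; the body — LINK, Z-thread, bridge and block-1
profile discharged, base datum / imports / numerics as rows, dominants `κ̄ ᾱ c̄r c̄c` of the link's constants and the names `W Z σ τ ψ Φ` — and the proof are W5's.
[cite: BenfattoGiulianiMastropietro2006, §2.3 (2.13)-(2.14), §2.8 (2.76)-(2.84), (2.93)-(2.98), §3 (3.2)-(3.8)] -/
theorem klTowerBornWtAt_le_law_of_blocks_klEng_tokX_unif (R : RenConsts) (c'' : ℝ) (hc'' : 0 < c'') :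
    ∃ C₁ C₂ Cκ CJ : ℝ, 0 < C₁ ∧ 0 < C₂ ∧ 0 < Cκ ∧ 0 < CJ ∧ ∀ d : ℕ, ∃ Cb : ℝ, 0 < Cb ∧ (R.WF2 → ∃ c₃' : ℝ, 0 < c₃' ∧ ∃ U₀' : ℝ, 0 < U₀' ∧
      ∀ (G : GeoConsts) (P : SplitConsts) (Q : EngConsts) (c : ℝ), P.WF → 0 < c → c ≤ klEngC₃6 P R → c ≤ c₃' →
      ∀ μ ∈ klWindowC, ∀ U : ℝ, 0 < U → U ≤ klEngU₀9 P R c → U ≤ U₀' → c'' * U ≤ 1 →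
      ∀ β : ℝ, klBetaMin ≤ β → β ≤ Real.exp (c / U ^ 2) →
      ∀ (L M : ℕ) [NeZero L] [NeZero M], klEngL₃ β U ≤ L → klEngM₃ β U L ≤ M →
      ∀ n : ℕ, 1 ≤ n → n ≤ nScales β + 1 → IsKLRegime U c (-(n : ℤ)) → HistP klPredsV17F2 L M G P Q R β U μ 0 n →
        (∀ m', 1 ≤ m' → m' < n → FlowPieceOscAt L M c'' β U μ m') →
      2 ≤ d → ∀ Kb j : ℕ, 1 ≤ Kb → d * Kb ≤ j → j ≤ n →
      ∀ D : ℕ, 3 ≤ D → (∀ k, 1 ≤ k → k ≤ Kb → Fintype.card (SpaceTimeIdx L M × SectorLeg (sectorCount (d * k - 1))) / 2 ≤ D) →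
      ∀ (A lam Q' Ab Qb : ℝ), 0 ≤ A → 0 < lam → 0 < Q' → 0 ≤ Ab → 0 ≤ Qb →
      -- the base datum of `𝒱_d` at `(F_{d−1}, rate j)` and its unit law [p3 class]
      ∀ Nb : ℕ → ℝ, (∀ p, 0 ≤ Nb p) →
        (∀ (p : ℕ) (q : Fin (2 * p)) (w' : SpaceTimeIdx L M × SectorLeg (sectorCount (d - 1))),
          klWtPinnedSumAt L M β μ (klFlowFrameU L M β U μ n) (d - 1) j (2 * p) (klTowerInput L M β U μ (klFlowFrameU L M β U μ n) d 1) q w' ≤ Nb p) →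
        (∀ p : ℕ, 3 ≤ p → Nb p / klLevUnitF β M 0 p (d - 1) ≤ Ab * lam ^ (p - 1) * Qb ^ p) →
      hubbardEffPartitionFnCT L M β U μ 0 (klFlowFrameU L M β U μ n) (klScale klE0 d) ≠ 0 →
      -- the names
      -- the k-free bounds: ANY dominants of the LINK's constants (so that a read-out step may share them)
      ∀ (κb αb crb ccb : ℝ), Real.sqrt (2 * Cκ * klE0) ≤ κb → Cb * ((M : ℝ) / β) * (4 : ℝ) ^ d / klE0 ≤ αb →
        81 * CJ * M / β ≤ crb → 162 * CJ * M / β ≤ ccb →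
      ∀ (W Z σ τ ψ Φ : ℝ),
        W = 32 * crb / ccb → Z = imagTimeWeight β M ^ 2 * ccb ^ 2 / 8 →
        σ = κb ^ 2 / ccb ^ 2 → τ = 4 * exp 4 * κb ^ 2 / ccb ^ 2 → ψ = ccb ^ 2 / κb ^ 2 → Φ = exp 1 * αb * ccb / (κb ^ 2 * crb) →
      ∀ (A' Q'' : ℝ),
        W * ((C₁ / C₂) * (8 : ℝ) ^ (d - 1) * (Ab + A / (1 - ((2 : ℝ) ^ d)⁻¹))) ≤ A' →
        Z * (C₂ ^ 2 * ((2 : ℝ) ^ (d - 1))⁻¹ * max Q' Qb) ≤ Q'' → W * Ab ≤ A' → Z * Qb ≤ Q'' → 0 < Q'' →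
      -- the weighted imports (degrees 2, 4, 6) at every block 1 ≤ k ≤ Kb [E1 class]
      ∀ (ι₁ ι₂ ι₃ : ℝ),
      (∀ k, 1 ≤ k → k ≤ Kb → W * Z ^ 1 *
        (klTowerMeasWtAt L M β U μ (klFlowFrameU L M β U μ n) d k j (2 * 1) / klLevUnitF β M 0 1 (d * k - 1)) ≤ ι₁ * lam) →
      (∀ k, 1 ≤ k → k ≤ Kb → W * Z ^ 2 *
        (klTowerMeasWtAt L M β U μ (klFlowFrameU L M β U μ n) d k j (2 * 2) / klLevUnitF β M 0 2 (d * k - 1)) ≤ ι₂ * lam) →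
      (∀ k, 1 ≤ k → k ≤ Kb → W * Z ^ 3 *
        (klTowerMeasWtAt L M β U μ (klFlowFrameU L M β U μ n) d k j (2 * 3) / klLevUnitF β M 0 3 (d * k - 1)) ≤ ι₃ * lam ^ 2) →
      -- the kit's numerics [p4 class]
      4 * σ * lam * Q'' < 1 → 2 * lam * τ * Q'' ≤ 1 → exp 1 * τ * lam * Q'' < 1 →
      Φ * (τ * (ι₁ * lam + ι₂ / (2 * Q'') + ι₃ / (4 * Q'' ^ 2) + A' * Q'' / 4)) < 1 →
      Φ * (exp 1 * τ * (ι₁ * lam) + (exp 1 * τ) ^ 2 * (ι₂ * lam) + (exp 1 * τ) ^ 3 * (ι₃ * lam ^ 2) +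
        A' * (exp 1 * τ * Q'') * ((exp 1 * τ * lam * Q'') ^ 3 / (1 - exp 1 * τ * lam * Q''))) < 1 →
      4 * Q'' ≤ Q' → 2 * τ * ψ * Q'' ≤ Q' →
      A' * (4 * Q'') ^ 3 * (4 * σ * lam * Q'' / (1 - 4 * σ * lam * Q'')) +
        exp 1 * ψ * (2 * τ * ψ * Q'') ^ 2 * (τ * (ι₁ * lam + ι₂ / (2 * Q'') + ι₃ / (4 * Q'' ^ 2) + A' * Q'' / 4)) *
          (Φ * (τ * (ι₁ * lam + ι₂ / (2 * Q'') + ι₃ / (4 * Q'' ^ 2) + A' * Q'' / 4)) /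
            (1 - Φ * (τ * (ι₁ * lam + ι₂ / (2 * Q'') + ι₃ / (4 * Q'' ^ 2) + A' * Q'' / 4)))) ≤ A * Q' ^ 3 →
      (∀ k, 1 ≤ k → k ≤ Kb → hubbardEffPartitionFnCT L M β U μ 0 (klFlowFrameU L M β U μ n) (klScale klE0 (d * k)) ≠ 0) ∧
      (∀ k, 2 ≤ k → k ≤ Kb → ∀ p : ℕ, 3 ≤ p → p ≤ D →
        klTowerBornWtAt L M β U μ (klFlowFrameU L M β U μ n) d (k - 1) j (2 * p) / klLevUnitF β M 0 p (d * (k - 1)) ≤ A * lam ^ (p - 1) * Q' ^ p) ∧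
      (∀ k, 1 ≤ k → k ≤ Kb → ∀ m, 4 ≤ m → m ≤ D → W * Z ^ m *
        (klTowerMeasWtAt L M β U μ (klFlowFrameU L M β U μ n) d k j (2 * m) / klLevUnitF β M 0 m (d * k - 1)) ≤ A' * lam ^ (m - 1) * Q'' ^ m)) := by
  obtain ⟨C₁, C₂, hC₁, hC₂, hbr⟩ := klTowerBornWtAt_le_law_of_base_rows_klEng_tokX R c'' hc''
  obtain ⟨Cκ, CJ, hCκ, hCJ, hlinkU⟩ := linkDataW_klEng_unif R c'' hc''
  refine ⟨C₁, C₂, Cκ, CJ, hC₁, hC₂, hCκ, hCJ, fun d => ?_⟩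
  obtain ⟨Cb, hCb, hlink⟩ := hlinkU d
  refine ⟨Cb, hCb, fun hR2 => ?_⟩
  obtain ⟨c₃, hc₃, U₀, hU₀, hbr'⟩ := hbr hR2
  refine ⟨c₃, hc₃, U₀, hU₀, ?_⟩
  intro G P Q c hP hc hc6 hc₃' μ hμ U hU hU9 hU₀' hcU β hβmin hβc L M _ _ hL3 hM3 n hn1 hnN hkl hhist hosc hd Kb j hKb1 hKbj hjn D hD3 hD
    A lam Q' Ab Qb hA hlam hQ hAb hQb Nb hNb0 hcar hlawb hZd κb αb crb ccb hκb hαb hcrb hccb W Z σ τ ψ Φ hW hZ' hσ hτ hψ hΦ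
    A' Q'' hA'1 hQ'1 hA'2 hQ'2 hQ'0 ι₁ ι₂ ι₃ hι₁ hι₂ hι₃ hx₁ hx₂ hx₃ hy hθ hu₁ hu₂ hclose
  have he : (0 : ℝ) < klE0 := by norm_num [klE0]
  have hβ : 0 < β := KLRegimeSplit.pos_of_klBetaMin_le hβmin
  have hM0 : (0 : ℝ) < M := Nat.cast_pos.2 (Nat.pos_of_ne_zero (NeZero.ne M))
  have hx : 0 < imagTimeWeight β M := imagTimeWeight_pos_of_pos (M := M) hβ
  have hfr : FrameOK R U (nScales β) μ (klFlowFrameU L M β U μ n) := frameOK_klFlowFrameU_of_histP_le hR2 hn1 le_rfl hnN hhist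
  set K : TrigPolyC4v := klFlowFrameU L M β U μ n with hKdef
  -- the four k-free constants are positive; so are the six names
  have hsq0 : 0 < Real.sqrt (2 * Cκ * klE0) := Real.sqrt_pos.2 (by positivity)
  have hκb0 : 0 < κb := lt_of_lt_of_le hsq0 hκb
  have hαb0 : 0 < αb := lt_of_lt_of_le (by positivity) hαb
  have hcrb0 : 0 < crb := lt_of_lt_of_le (by positivity) hcrb
  have hccb0 : 0 < ccb := lt_of_lt_of_le (by positivity) hccb
  have hκbsq : Real.sqrt (2 * Cκ * klE0) ^ 2 ≤ κb ^ 2 := pow_le_pow_left₀ hsq0.le hκb 2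
  have hW0 : 0 < W := by rw [hW]; positivity
  have hZ0 : 0 < Z := by rw [hZ']; positivity
  have hσ0 : 0 ≤ σ := by rw [hσ]; positivity
  have hτ0 : 0 < τ := by rw [hτ]; positivity
  have hψ0 : 0 ≤ ψ := by rw [hψ]; positivity
  have hΦ0 : 0 ≤ Φ := by rw [hΦ]; positivity
  -- block ranges
  have hblk : ∀ k, 1 ≤ k → k < Kb → 2 ≤ d * k ∧ d * (k + 1) ≤ nScales β + 1 ∧ d * k ≤ n ∧ d * k ≤ j := by
    intro k hk1 hk
    have h1 : d * (k + 1) ≤ d * Kb := Nat.mul_le_mul_left d (by omega)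
    have h2 : d * k + d = d * (k + 1) := (Nat.mul_succ d k).symm
    refine ⟨le_trans hd (Nat.le_mul_of_pos_right d hk1), by omega, by omega, by omega⟩
  -- the per-block data, ONE bundle for the step and the Z-thread
  set κf : ℕ → ℝ := fun k => Real.sqrt (Cκ * (klScale klE0 (d * k) / klScale klE0 (d * k - 1)) * (klE0 * ((8 : ℝ) ^ (d * k - 1))⁻¹)) with hκf
  set αf : ℕ → ℝ := fun k => Cb * ((M : ℝ) / β) / klScale klE0 (d * (k + 1)) with hαf
  have hdata : ∀ k, 1 ≤ k → k < Kb →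
      0 < κf k ∧ κf k ^ 2 * (8 : ℝ) ^ (d * k) ≤ κb ^ 2 ∧
      IsGramBoundedR ((sectorSubMatrix L M β (bgmFatMultiplier L M klE0 β (nambuXiCT L μ K) (d * k - 1))).transpose *
        hubbardCovSliceCT L M β μ 0 K (klScale klE0 (d * (k + 1))) (klScale klE0 (d * k)) *
          sectorSubMatrix L M β (bgmFatMultiplier L M klE0 β (nambuXiCT L μ K) (d * k - 1))) (κf k) ∧
      (∀ X, ∑ Y, ‖((sectorSubMatrix L M β (bgmFatMultiplier L M klE0 β (nambuXiCT L μ K) (d * k - 1))).transpose *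
        hubbardCovSliceCT L M β μ 0 K (klScale klE0 (d * (k + 1))) (klScale klE0 (d * k)) *
          sectorSubMatrix L M β (bgmFatMultiplier L M klE0 β (nambuXiCT L μ K) (d * k - 1))) X Y‖ *
        klScaleWt L M β j {latticeLegPos (2 * (2 * M)) X, latticeLegPos (2 * (2 * M)) Y} ≤ αf k) ∧
      (∀ Y, ∑ X, ‖((sectorSubMatrix L M β (bgmFatMultiplier L M klE0 β (nambuXiCT L μ K) (d * k - 1))).transpose *
        hubbardCovSliceCT L M β μ 0 K (klScale klE0 (d * (k + 1))) (klScale klE0 (d * k)) *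
          sectorSubMatrix L M β (bgmFatMultiplier L M klE0 β (nambuXiCT L μ K) (d * k - 1))) X Y‖ *
        klScaleWt L M β j {latticeLegPos (2 * (2 * M)) X, latticeLegPos (2 * (2 * M)) Y} ≤ αf k) ∧
      αf k ≤ αb * (4 : ℝ) ^ (d * k) ∧
      (∀ X'', ∑ X', ‖(sectorAnalysisMatrix L M β (klAnisoFamily L M β μ K klE0 (d * k)) *
        sectorSubMatrix L M β (bgmFatMultiplier L M klE0 β (nambuXiCT L μ K) (d * k - 1))) X'' X'‖ *
        klScaleWt L M β j {latticeLegPos (2 * (2 * M)) X'', latticeLegPos (2 * (2 * M)) X'} ≤ crb) ∧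
      (∀ X', ∑ X'', ‖(sectorAnalysisMatrix L M β (klAnisoFamily L M β μ K klE0 (d * k)) *
        sectorSubMatrix L M β (bgmFatMultiplier L M klE0 β (nambuXiCT L μ K) (d * k - 1))) X'' X'‖ *
        klScaleWt L M β j {latticeLegPos (2 * (2 * M)) X'', latticeLegPos (2 * (2 * M)) X'} ≤ ccb) := by
    intro k hk1 hk
    obtain ⟨hdk, hkN, hkn, hkj⟩ := hblk k hk1 hk
    obtain ⟨h1, h2, h3, h4, h5, h6, h7, h8⟩ := hlink G P Q c hP hR2 hc hc6 μ hμ U hU hU9 hcU β hβmin hβc L M hL3 hM3 n hn1 hnN hkl hhist hfr hosc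
      k hk1 hdk hkN hkn j hkj
    refine ⟨h1, h2.trans hκbsq, h3, h4, h5, h6.trans (mul_le_mul_of_nonneg_right hαb (by positivity)), fun X'' => (h7 X'').trans hcrb,
      fun X' => (h8 X').trans hccb⟩
  -- the step (W2) and the Z-thread (W4) from the bundle
  have hstep := wtLaw_hstep_of_blockBounds (L := L) (M := M) hβ U μ K (by omega : 1 ≤ d) j Kb hκb0 hαb0 hcrb0 hccb0 κf αf
    (fun k hk1 hk => (hdata k hk1 hk).1) (fun k hk1 hk => (hdata k hk1 hk).2.1) (fun k hk1 hk => (hdata k hk1 hk).2.2.2.2.2.1)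
    (fun k hk1 hk => (hdata k hk1 hk).2.2.1) (fun k hk1 hk => (hdata k hk1 hk).2.2.2.1) (fun k hk1 hk => (hdata k hk1 hk).2.2.2.2.1)
    (fun k hk1 hk => (hdata k hk1 hk).2.2.2.2.2.2.1) (fun k hk1 hk => (hdata k hk1 hk).2.2.2.2.2.2.2) (fun k hk1 hk => hD k hk1 hk.le)
    W Z σ τ ψ Φ hW hZ' hσ hτ hψ hΦ
  have hZsucc := wtLaw_hZsucc_of_blockBounds (L := L) (M := M) hβ U μ K (by omega : 1 ≤ d) j Kb hκb0 hαb0 hcrb0 hccb0 κf αf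
    (fun k hk1 hk => (hdata k hk1 hk).1) (fun k hk1 hk => (hdata k hk1 hk).2.1) (fun k hk1 hk => (hdata k hk1 hk).2.2.2.2.2.1)
    (fun k hk1 hk => (hdata k hk1 hk).2.2.1) (fun k hk1 hk => (hdata k hk1 hk).2.2.2.1) (fun k hk1 hk => (hdata k hk1 hk).2.2.2.2.1)
    (fun k hk1 hk => hD k hk1 hk.le) W Z τ Φ hW hZ' hτ hΦ
  -- the block-1 profile from the base rows
  have hZ1 : hubbardEffPartitionFnCT L M β U μ 0 K (klScale klE0 (d * 1)) ≠ 0 := by rw [Nat.mul_one]; exact hZd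
  have hbase : ∀ m, 4 ≤ m → m ≤ D →
      W * Z ^ m * (klTowerMeasWtAt L M β U μ K d 1 j (2 * m) / klLevUnitF β M 0 m (d * 1 - 1)) ≤ A' * lam ^ (m - 1) * Q'' ^ m := by
    intro m hm hmD
    have hu0 : 0 < klLevUnitF β M 0 m (d - 1) := klLevUnitF_pos hβ 0 m _
    have hmeas : klTowerMeasWtAt L M β U μ K d 1 j (2 * m) ≤ Nb m :=
      klTowerMeasWtAt_le_of_rows β U μ K d 1 j (2 * m) (by omega : d * 1 - 1 = d - 1) (hNb0 m) (hcar m)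
    have h1 : klTowerMeasWtAt L M β U μ K d 1 j (2 * m) / klLevUnitF β M 0 m (d * 1 - 1) ≤ Ab * lam ^ (m - 1) * Qb ^ m := by
      rw [show d * 1 - 1 = d - 1 by omega]
      exact (div_le_div_of_nonneg_right hmeas hu0.le).trans (hlawb m (by omega))
    have hWZ : 0 ≤ W * Z ^ m := by positivity
    calc W * Z ^ m * (klTowerMeasWtAt L M β U μ K d 1 j (2 * m) / klLevUnitF β M 0 m (d * 1 - 1))
        ≤ W * Z ^ m * (Ab * lam ^ (m - 1) * Qb ^ m) := mul_le_mul_of_nonneg_left h1 hWZ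
      _ = (W * Ab) * lam ^ (m - 1) * (Z * Qb) ^ m := by rw [mul_pow]; ring
      _ ≤ A' * lam ^ (m - 1) * Q'' ^ m := by
          have hA'0 : 0 ≤ A' := le_trans (by positivity) hA'2
          exact mul_le_mul (mul_le_mul_of_nonneg_right hA'2 (pow_nonneg hlam.le _)) (pow_le_pow_left₀ (by positivity) hQ'2 m)
            (pow_nonneg (by positivity) _) (by positivity)
  -- W3b
  exact hbr' G P Q c hc hc6 hc₃' μ hμ U hU hU9 hU₀' hcU β hβmin hβc L M hL3 hM3 n hn1 hnN hkl hhist hosc d Kb D hd (by omega) hD3 j (by omega)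
    A lam Q' Ab Qb hA hlam hQ hAb hQb Nb hNb0 hcar hlawb W Z A' Q'' hW0 hZ0 hA'1 hQ'1 hQ'0 σ Φ ψ τ ι₁ ι₂ ι₃ hσ0 hΦ0 hψ0 hτ0
    (fun k => hubbardEffPartitionFnCT L M β U μ 0 K (klScale klE0 (d * k)) ≠ 0) hbase hι₁ hι₂ hι₃ hZ1 hZsucc hstep
    hx₁ hx₂ hx₃ hy hθ hu₁ hu₂ hclose

end Summit.HubbardSuperconductivity.HubbardSuperconductivity.Theorems.EngineV8

end
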